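import Literature.Computability.Complexity.FKPointLocationSearch
import Mathlib.Data.Int.Interval
import HarnessLib

/-!
# Fournier–Koiran point location, IV: one level — coarseness at all scales, chains, stable scale, apex

Topic `Literature/Computability/Complexity`, grouping namespace `FKPointLocation`. This file proves
that the data of ONE level `j ≥ 1` of a location certificate (`FKPointLocationCertificates.lean`:
the radius `ρ_j`, the apex `s_j`, with the apex property `Valid.apex` and the nearness
`Valid.s_near`) can be FOUND by the searches of Fournier–Koiran's Step k (ICALP 2000 = LIP
RR-1999-21, §2.1) rendered arithmetically: given the chart `χ`, the earlier apexes (which define the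
live family) and the dyadic centre `p = m / 2^{L+1}` of the little cube,

* `F sc` — the live forms whose trace meets the cube of radius `ρ_sc = 2^{κ·sc} / 2^{L+1}` around
  `p` (`H_n^k` of the report), `Isys sc` / `I sc` — the system "chart equations + `ℓ = 0 (ℓ ∈ F sc)`"
  and its solution set (`I^k = ⋂ H_n^k`); `I_nonempty` — COARSENESS at every scale `sc ≤ D+1`
  (Meyer auf der Heide), under the explicit parameter inequality `LevelParams.coarse`;
* chains: `Esys`/`E` (the affine spaces `E_1 ⊋ E_2 ⊋ ⋯`), `ValidTriple` (a form of `F sc` with a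
  SMALL rational point of `E` off it and one on it — the NP witness), `exists_validTriple` (if some
  form of `F sc` does not vanish on `E ⊇ I sc` then a valid triple exists: small witnesses,
  `FKPointLocationSystems.exists_small_mem_solSet`), `chainBuild` relative to an abstract selection
  `choose` (realised by prefix search in the protocol) and `E_chainBuild_eq_I` (after `D+1` slots the
  chain is complete: `E = I sc`, by the strict drop of `finrank (dirSub ·)`);
* the STABLE SCALE `scStar` (least `sc ≤ D` with no form of `F (sc+1)` cutting `I sc`;
  `exists_stable`, again by dimension) and `I_scStar_succ` (`I (scStar+1) = I scStar`) — this replaces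
  the report's fixed radius `r_n` by an adaptive one so that the apex can be taken NEAR the cube;
* the APEX: `ApexPred` (the arithmetic predicate searched by prefix search: a point `N/d` of
  `E(chain scStar)` within `ρ_{scStar+1}/4` of `p`, of width `W`), `exists_apexPred`
  (`FKPointLocationSystems.exists_near_mem_solSet` + `LevelParams.near`/`width`), and the level
  theorem `apex_property`: any such apex kills every live form meeting the cube of radius
  `ρ_{scStar+1}` — field `Valid.apex`.

## References

* H. Fournier, P. Koiran, *Lower bounds are not easier over the reals: inside PH*, ICALP 2000,
  LNCS 1853 = LIP RR-1999-21, §2.1 Steps 1 and k (cases (i)/(ii), the chain `E_i`, the apex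
  `s_n^k`, coarseness), §2.2. [FournierKoiran2000]
* F. Meyer auf der Heide, J. ACM 35 (1988), §2 (coarseness). [MeyerAufDerHeide1988]
-/

namespace Literature.Computability.Complexity

namespace FKPointLocation

open Finset Module

/-! ### Parameters of a level and their inequalities -/

/-- Numerical parameters of the location procedure in dimension `D`: coefficient bound `B ≥ 1` of the
live forms, binary-search depth `L+1` (`r = 2^{-(L+1)}`), scale exponent `κ` (`ρ_sc = 2^{κ sc} r`),
apex width `W`; with the inequalities used: COARSENESS at the largest scale, NEARNESS of the
generalized-inverse solution (`8 · rowBound · D B ≤ 2^κ`), `ρ_{D+1} ≤ 1`, and the WIDTH of apexes.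
[cite: FournierKoiran2000, §2.1–2.2 (the choice `1/r_n = n^{n²} 2^{2n² t(n)+O(n²)}` and the polynomial size of all coefficients)] -/
structure LevelParams where
  /-- ambient dimension (`n+1` after homogenisation) -/
  D : ℕ
  /-- bound on the coefficients of live forms -/
  B : ℕ
  /-- binary search depth minus one -/
  L : ℕ
  /-- scale exponent -/
  κ : ℕ
  /-- width (in bits) of apex numerators and denominators -/
  W : ℕ
  D_pos : 0 < D
  one_le_B : 1 ≤ B
  coarse : D * B * 2 ^ (κ * (D + 1)) * ((1 + D * D * B) * (D.factorial * B ^ D)) < 2 ^ (L + 1)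
  near : 8 * (rowBound D B * (D * B)) ≤ 2 ^ κ
  three_le : 3 ≤ κ
  small : 2 ^ (κ * (D + 1)) ≤ 2 ^ (L + 1)
  width : 2 ^ (L + 1) * detBound D B + rowBound D B * (D * B * 2 ^ (κ * D)) < 2 ^ W

namespace LevelParams

variable (Q : LevelParams)

/-- `max B 1 = B`. [folklore] -/
theorem max_B : max Q.B 1 = Q.B := max_eq_left Q.one_le_B

/-- `detBound D B = D! B^D`. [folklore] -/
theorem detBound_eq : detBound Q.D Q.B = Q.D.factorial * Q.B ^ Q.D := by
  rw [detBound, Q.max_B]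

/-- The radius of scale `sc`: `ρ_sc = 2^{κ sc} / 2^{L+1}`. [cite: FournierKoiran2000, §2.1] -/
def ρ (sc : ℕ) : ℚ := 2 ^ (Q.κ * sc) / 2 ^ (Q.L + 1)

/-- The binary-search radius `r = 2^{-(L+1)}`. [cite: FournierKoiran2000, §2.1 Step 1] -/
def r : ℚ := 1 / 2 ^ (Q.L + 1)

/-- `0 < ρ_sc`. [folklore] -/
theorem ρ_pos (sc : ℕ) : 0 < Q.ρ sc := by unfold ρ; positivity

/-- `ρ` is monotone in the scale. [folklore] -/
theorem ρ_mono {sc sc' : ℕ} (h : sc ≤ sc') : Q.ρ sc ≤ Q.ρ sc' := by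
  unfold ρ
  refine div_le_div_of_nonneg_right ?_ (by positivity)
  exact_mod_cast Nat.pow_le_pow_right (by norm_num) (Nat.mul_le_mul_left _ h)

/-- `ρ_sc ≤ 1` for `sc ≤ D+1`. [folklore] -/
theorem ρ_le_one {sc : ℕ} (h : sc ≤ Q.D + 1) : Q.ρ sc ≤ 1 := by
  refine (Q.ρ_mono h).trans ?_
  unfold ρ
  rw [div_le_one (by positivity)]
  exact_mod_cast Q.small

/-- `4 r ≤ ρ_sc` for `sc ≥ 1` (`κ ≥ 3`). [folklore] -/
theorem r_le_ρ_div_four {sc : ℕ} (h : 1 ≤ sc) : Q.r ≤ Q.ρ sc / 4 := by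
  have h1 : Q.ρ 1 ≤ Q.ρ sc := Q.ρ_mono h
  have h8 : (8 : ℚ) ≤ 2 ^ (Q.κ * 1) := by
    rw [mul_one]
    calc (8 : ℚ) = 2 ^ 3 := by norm_num
      _ ≤ 2 ^ Q.κ := by exact_mod_cast Nat.pow_le_pow_right (by norm_num) Q.three_le
  unfold ρ r at *
  have hpos : (0 : ℚ) < 2 ^ (Q.L + 1) := by positivity
  rw [le_div_iff₀ (by norm_num : (0:ℚ) < 4)]
  calc 1 / 2 ^ (Q.L + 1) * 4 = 4 / 2 ^ (Q.L + 1) := by ring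
    _ ≤ 2 ^ (Q.κ * 1) / 2 ^ (Q.L + 1) := div_le_div_of_nonneg_right (by linarith) hpos.le
    _ ≤ 2 ^ (Q.κ * sc) / 2 ^ (Q.L + 1) := h1

end LevelParams

/-! ### The data of a level -/

/-- The context of a level `j ≥ 1`: chart, numerators of the earlier apexes (defining the live
family), and the numerators `m` of the dyadic centre `p = m / 2^{L+1}` (on fixed coordinates
`p_i = χ_i`). [cite: FournierKoiran2000, §2.1 Step k] -/
structure LevelCtx (Q : LevelParams) where
  /-- the chart (`0` free, `±1` fixed) -/
  χ : Fin Q.D → ℤ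
  /-- numerators of earlier apexes -/
  prev : List (Fin Q.D → ℤ)
  /-- numerators of the centre over `2^{L+1}` -/
  m : Fin Q.D → ℤ

namespace LevelCtx

variable {Q : LevelParams} (Λ : LevelCtx Q)

/-- Well-formedness of a level context: chart values are `0, ±1`, the centre lies in the chart and
in the closed unit cube. [cite: FournierKoiran2000, §2.1] -/
structure WF : Prop where
  /-- chart values are `0, ±1` -/
  hχ : ∀ i, Λ.χ i = 0 ∨ Λ.χ i = 1 ∨ Λ.χ i = -1
  /-- the centre lies in the chart -/
  hm : ∀ i, Λ.χ i ≠ 0 → Λ.m i = Λ.χ i * 2 ^ (Q.L + 1)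
  /-- the centre lies in `[-1,1]` (closed): `|m_i| ≤ 2^{L+1}` -/
  hm_le : ∀ i, (Λ.m i).natAbs ≤ 2 ^ (Q.L + 1)

/-- The centre `p = m / 2^{L+1}` as a rational point. [cite: FournierKoiran2000, §2.1] -/
def pC : Fin Q.D → ℚ := fun i => (Λ.m i : ℚ) / 2 ^ (Q.L + 1)

/-- `p` lies in the chart. [folklore] -/
theorem pC_fixed (hW : Λ.WF) (i : Fin Q.D) (h : Λ.χ i ≠ 0) : Λ.pC i = Λ.χ i := by
  simp only [pC, hW.hm i h]; push_cast; field_simp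

/-- INTEGER LIVENESS: coefficients bounded by `B` and orthogonal to all earlier apex numerators.
[cite: FournierKoiran2000, §2.1 (`H_n^k`: hyperplanes through all earlier tops)] -/
def LiveI (a : Fin Q.D → ℤ) : Prop :=
  (∀ i, (a i).natAbs ≤ Q.B) ∧ ∀ σ ∈ Λ.prev, ∑ i, a i * σ i = 0

/-- INTEGER MEETING TEST at scale `sc`: `|a·m| ≤ 2^{κ sc} ∑_{free} |a_i|` (the test `meets_iff`
cleared of the denominator `2^{L+1}`). [cite: FournierKoiran2000, §2.1] -/
def MeetsI (sc : ℕ) (a : Fin Q.D → ℤ) : Prop :=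
  (∑ i, a i * Λ.m i).natAbs ≤ 2 ^ (Q.κ * sc) * ∑ i ∈ univ.filter (fun i => Λ.χ i = 0), (a i).natAbs

/-- The integer test is the geometric one. [cite: FournierKoiran2000, §2.1] -/
theorem meetsI_iff (hW : Λ.WF) (sc : ℕ) (a : Fin Q.D → ℤ) : Λ.MeetsI sc a ↔ Meets Λ.χ Λ.pC (Q.ρ sc) a := by
  rw [meets_iff (fun i h => Λ.pC_fixed hW i h) (Q.ρ_pos sc).le]
  have hq : (0 : ℚ) < 2 ^ (Q.L + 1) := by positivity
  have hsum : ∑ i, (a i : ℚ) * Λ.pC i = (∑ i, a i * Λ.m i : ℤ) / 2 ^ (Q.L + 1) := by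
    simp only [pC]; push_cast; rw [Finset.sum_div]
    exact sum_congr rfl fun i _ => by ring
  rw [hsum, abs_div, abs_of_pos hq, LevelParams.ρ, div_mul_eq_mul_div, div_le_div_iff_of_pos_right hq,
    ← Int.cast_abs, ← Nat.cast_natAbs, MeetsI]
  constructor
  · intro h; exact_mod_cast h
  · intro h; exact_mod_cast h

open Classical in
/-- The family `F sc` of live forms meeting the cube of scale `sc` (a finite set).
[cite: FournierKoiran2000, §2.1 (`H_n^k = {h ∈ H_n^{k-1} : h ∩ c_n^k ≠ ∅}`)] -/
noncomputable def F (sc : ℕ) : Finset (Fin Q.D → ℤ) :=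
  (Fintype.piFinset fun _ : Fin Q.D => Icc (-(Q.B : ℤ)) Q.B).filter fun a => Λ.LiveI a ∧ Λ.MeetsI sc a

/-- Membership in `F sc`. [folklore] -/
theorem mem_F {sc : ℕ} {a : Fin Q.D → ℤ} : a ∈ Λ.F sc ↔ Λ.LiveI a ∧ Λ.MeetsI sc a := by
  classical
  unfold F
  rw [mem_filter, Fintype.mem_piFinset]
  constructor
  · exact fun h => h.2
  · intro h
    refine ⟨fun i => ?_, h⟩
    rw [mem_Icc]
    have := h.1.1 i
    omega

/-- `F` grows with the scale. [folklore] -/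
theorem F_mono {sc sc' : ℕ} (h : sc ≤ sc') : Λ.F sc ⊆ Λ.F sc' := by
  intro a ha
  rw [mem_F] at ha ⊢
  refine ⟨ha.1, ha.2.trans (Nat.mul_le_mul_right _ (Nat.pow_le_pow_right (by norm_num) ?_))⟩
  exact Nat.mul_le_mul_left _ h

/-- The chart equations `y_i = χ_i` (fixed `i`). [cite: FournierKoiran2000, §2.1] -/
def chartEqns : List (Eqn Q.D) :=
  (List.finRange Q.D).filterMap fun i => if Λ.χ i = 0 then none else some (Pi.single i 1, Λ.χ i)

/-- Membership in the chart equations. [folklore] -/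
theorem mem_chartEqns {e : Eqn Q.D} : e ∈ Λ.chartEqns ↔ ∃ i, Λ.χ i ≠ 0 ∧ e = (Pi.single i 1, Λ.χ i) := by
  simp only [chartEqns, List.mem_filterMap, List.mem_finRange, true_and]
  constructor
  · rintro ⟨i, hi⟩
    by_cases h : Λ.χ i = 0
    · simp [h] at hi
    · simp only [h, if_false, Option.some.injEq] at hi
      exact ⟨i, h, hi.symm⟩
  · rintro ⟨i, hi, rfl⟩
    exact ⟨i, by simp [hi]⟩

/-- `lin (e_i) y = y_i`. [folklore] -/
theorem lin_single (i : Fin Q.D) (y : Fin Q.D → ℝ) : lin (Pi.single i (1 : ℤ)) y = y i := by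
  classical
  simp only [lin, Pi.single_apply]
  rw [sum_eq_single i]
  · simp
  · intro j _ hj; simp [hj]
  · simp

/-- Solutions of the chart equations are the points of the chart. [folklore] -/
theorem mem_solSet_chartEqns_iff (y : Fin Q.D → ℝ) :
    y ∈ SolSet Λ.chartEqns ↔ ∀ i, Λ.χ i ≠ 0 → y i = Λ.χ i := by
  simp only [SolSet, Set.mem_setOf_eq]
  constructor
  · intro h i hi
    have := h _ (Λ.mem_chartEqns.2 ⟨i, hi, rfl⟩)
    rwa [lin_single] at this
  · intro h e he
    obtain ⟨i, hi, rfl⟩ := Λ.mem_chartEqns.1 he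
    rw [lin_single]; exact h i hi

/-- The system of a chain: chart equations and `ℓ = 0` for the chain's forms.
[cite: FournierKoiran2000, §2.1 (the spaces `E_i`)] -/
def Esys (ch : List (Fin Q.D → ℤ)) : List (Eqn Q.D) := Λ.chartEqns ++ ch.map fun a => (a, 0)

/-- The affine space of a chain. [cite: FournierKoiran2000, §2.1] -/
def E (ch : List (Fin Q.D → ℤ)) : Set (Fin Q.D → ℝ) := SolSet (Λ.Esys ch)

/-- Membership in `E ch`. [folklore] -/
theorem mem_E_iff (ch : List (Fin Q.D → ℤ)) (y : Fin Q.D → ℝ) :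
    y ∈ Λ.E ch ↔ (∀ i, Λ.χ i ≠ 0 → y i = Λ.χ i) ∧ ∀ a ∈ ch, lin a y = 0 := by
  rw [E, Esys, SolSet]
  simp only [Set.mem_setOf_eq, List.mem_append, List.mem_map]
  constructor
  · intro h
    refine ⟨(Λ.mem_solSet_chartEqns_iff y).1 fun e he => h e (Or.inl he), fun a ha => ?_⟩
    have := h (a, 0) (Or.inr ⟨a, ha, rfl⟩)
    simpa using this
  · rintro ⟨h1, h2⟩ e (he | ⟨a, ha, rfl⟩)
    · exact (Λ.mem_solSet_chartEqns_iff y).2 h1 e he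
    · simpa using h2 a ha

/-- The system of scale `sc`: the chain of ALL forms of `F sc`. [cite: FournierKoiran2000, §2.1 (`I^k`)] -/
noncomputable def Isys (sc : ℕ) : List (Eqn Q.D) := Λ.Esys (Λ.F sc).toList

/-- `I sc = G ∩ ⋂_{ℓ ∈ F sc} ker ℓ`. [cite: FournierKoiran2000, §2.1 (`I^k = ⋂_{h ∈ H^k} h`)] -/
noncomputable def I (sc : ℕ) : Set (Fin Q.D → ℝ) := SolSet (Λ.Isys sc)

/-- Membership in `I sc`. [folklore] -/
theorem mem_I_iff (sc : ℕ) (y : Fin Q.D → ℝ) :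
    y ∈ Λ.I sc ↔ (∀ i, Λ.χ i ≠ 0 → y i = Λ.χ i) ∧ ∀ a ∈ Λ.F sc, lin a y = 0 := by
  rw [I, Isys, ← E, mem_E_iff]
  simp only [Finset.mem_toList]

/-- `I` decreases with the scale. [folklore] -/
theorem I_antitone {sc sc' : ℕ} (h : sc ≤ sc') : Λ.I sc' ⊆ Λ.I sc := by
  intro y hy
  rw [mem_I_iff] at hy ⊢
  exact ⟨hy.1, fun a ha => hy.2 a (Λ.F_mono h ha)⟩

/-! ### Entry bounds of the systems -/

/-- Coefficients of chart-and-forms systems are bounded by `B` (since `B ≥ 1`). [folklore] -/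
theorem esys_entries_le {ch : List (Fin Q.D → ℤ)} (hch : ∀ a ∈ ch, ∀ k, (a k).natAbs ≤ Q.B) :
    ∀ e ∈ Λ.Esys ch, ∀ k, (e.1 k).natAbs ≤ Q.B := by
  classical
  intro e he k
  rw [Esys, List.mem_append, List.mem_map] at he
  rcases he with he | ⟨a, ha, rfl⟩
  · obtain ⟨i, -, rfl⟩ := Λ.mem_chartEqns.1 he
    simp only [Pi.single_apply]
    split_ifs <;> simp [Q.one_le_B]
  · exact hch a ha k

/-- Constants of chart-and-forms systems are bounded by `1`. [folklore] -/
theorem esys_consts_le (hW : Λ.WF) (ch : List (Fin Q.D → ℤ)) : ∀ e ∈ Λ.Esys ch, e.2.natAbs ≤ 1 := by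
  intro e he
  rw [Esys, List.mem_append, List.mem_map] at he
  rcases he with he | ⟨a, -, rfl⟩
  · obtain ⟨i, -, rfl⟩ := Λ.mem_chartEqns.1 he
    rcases hW.hχ i with h | h | h <;> simp [h]
  · simp

/-- Forms of `F sc` are bounded by `B`. [folklore] -/
theorem F_entries_le {sc : ℕ} {a : Fin Q.D → ℤ} (ha : a ∈ Λ.F sc) (k : Fin Q.D) : (a k).natAbs ≤ Q.B :=
  (Λ.mem_F.1 ha).1.1 k

/-! ### Coarseness at every scale -/

/-- **Coarseness**: `I sc ≠ ∅` for every scale `sc ≤ D+1` (all live forms meeting the cube of radius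
`ρ_sc` around `p`, together with the chart, have a common point). [cite: MeyerAufDerHeide1988, §2; FournierKoiran2000, §2.1 case (ii) ("`⋂_{h ∈ H_n^1} h ≠ ∅` by definition of coarseness")] -/
theorem I_nonempty (hW : Λ.WF) {sc : ℕ} (hsc : sc ≤ Q.D + 1) : (Λ.I sc).Nonempty := by
  classical
  have hB := Λ.esys_entries_le (ch := (Λ.F sc).toList) (fun a ha k => Λ.F_entries_le (Finset.mem_toList.1 ha) k)
  -- residuals at the centre
  set p : Fin Q.D → ℝ := fun i => (Λ.pC i : ℝ) with hp
  have hq : (0 : ℝ) < 2 ^ (Q.L + 1) := by positivity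
  have hres : ∀ e ∈ Λ.Isys sc, |(e.2 : ℝ) - lin e.1 p| ≤ (Q.D * Q.B : ℕ) * (Q.ρ sc : ℝ) := by
    intro e he
    rw [Isys, Esys, List.mem_append, List.mem_map] at he
    rcases he with he | ⟨a, ha, rfl⟩
    · obtain ⟨i, hi, rfl⟩ := Λ.mem_chartEqns.1 he
      rw [lin_single, hp]
      simp only [Λ.pC_fixed hW i hi, Rat.cast_intCast, sub_self, abs_zero]
      have := (Q.ρ_pos sc).le
      positivity
    · rw [Finset.mem_toList, mem_F] at ha
      have hmeets := ha.2
      simp only [Int.cast_zero, zero_sub, abs_neg]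
      -- `|lin a p| = |a·m| / 2^{L+1} ≤ 2^{κ sc} (∑_free |a_i|) / 2^{L+1} ≤ D B ρ_sc`
      have h1 : lin a p = ((∑ i, a i * Λ.m i : ℤ) : ℝ) / 2 ^ (Q.L + 1) := by
        simp only [lin, hp, pC]; push_cast; rw [sum_div]
        exact sum_congr rfl fun i _ => by ring
      have h2 : ((∑ i, a i * Λ.m i : ℤ).natAbs : ℝ) ≤
          2 ^ (Q.κ * sc) * ∑ i ∈ univ.filter (fun i => Λ.χ i = 0), ((a i).natAbs : ℝ) := by
        exact_mod_cast hmeets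
      have h3 : ∑ i ∈ univ.filter (fun i => Λ.χ i = 0), ((a i).natAbs : ℝ) ≤ (Q.D * Q.B : ℕ) := by
        calc ∑ i ∈ univ.filter (fun i => Λ.χ i = 0), ((a i).natAbs : ℝ)
            ≤ ∑ i : Fin Q.D, ((a i).natAbs : ℝ) :=
              sum_le_sum_of_subset_of_nonneg (filter_subset _ _) fun i _ _ => by positivity
          _ ≤ ∑ _i : Fin Q.D, (Q.B : ℝ) := sum_le_sum fun i _ => by exact_mod_cast ha.1.1 i
          _ = (Q.D * Q.B : ℕ) := by push_cast; simp
      rw [h1, abs_div, abs_of_pos hq, ← Int.cast_abs, Int.abs_eq_natAbs, Int.cast_natCast,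
        LevelParams.ρ]
      push_cast
      rw [mul_div_assoc', div_le_div_iff_of_pos_right hq]
      calc ((∑ i, a i * Λ.m i : ℤ).natAbs : ℝ)
          ≤ 2 ^ (Q.κ * sc) * ∑ i ∈ univ.filter (fun i => Λ.χ i = 0), ((a i).natAbs : ℝ) := h2
        _ ≤ 2 ^ (Q.κ * sc) * (Q.D * Q.B : ℕ) := mul_le_mul_of_nonneg_left h3 (by positivity)
        _ = (Q.D : ℝ) * Q.B * 2 ^ (Q.κ * sc) := by push_cast; ring
  refine solSet_nonempty_of_near (Λ.Isys sc) hB p hres ?_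
  -- the coarseness inequality
  rw [Q.max_B]
  have hρ : ((Q.ρ sc : ℚ) : ℝ) ≤ Q.ρ (Q.D + 1) := by exact_mod_cast Q.ρ_mono hsc
  have hρD : ((Q.ρ (Q.D + 1) : ℚ) : ℝ) * 2 ^ (Q.L + 1) = 2 ^ (Q.κ * (Q.D + 1)) := by
    simp only [LevelParams.ρ]; push_cast; field_simp
  have hcoarse : ((Q.D * Q.B * 2 ^ (Q.κ * (Q.D + 1)) * ((1 + Q.D * Q.D * Q.B) * (Q.D.factorial * Q.B ^ Q.D)) : ℕ) : ℝ) <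
      ((2 ^ (Q.L + 1) : ℕ) : ℝ) := by exact_mod_cast Q.coarse
  push_cast at hcoarse
  set K : ℝ := (1 + (Q.D : ℝ) * Q.D * Q.B) * (Q.D.factorial * (Q.B : ℝ) ^ Q.D) with hK
  have hK0 : 0 ≤ K := by rw [hK]; positivity
  have hDB : (0 : ℝ) ≤ ((Q.D * Q.B : ℕ) : ℝ) := by positivity
  have step1 : ((Q.D * Q.B : ℕ) : ℝ) * (Q.ρ sc : ℝ) * K ≤ ((Q.D * Q.B : ℕ) : ℝ) * (Q.ρ (Q.D + 1) : ℝ) * K := by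
    gcongr
  have step2 : ((Q.D * Q.B : ℕ) : ℝ) * (Q.ρ (Q.D + 1) : ℝ) * K * 2 ^ (Q.L + 1) < 2 ^ (Q.L + 1) := by
    have : ((Q.D * Q.B : ℕ) : ℝ) * (Q.ρ (Q.D + 1) : ℝ) * K * 2 ^ (Q.L + 1) =
        (Q.D : ℝ) * Q.B * 2 ^ (Q.κ * (Q.D + 1)) * K := by
      rw [← hρD]; push_cast; ring
    rw [this, hK]
    linarith [hcoarse]
  have step3 : ((Q.D * Q.B : ℕ) : ℝ) * (Q.ρ (Q.D + 1) : ℝ) * K < 1 := by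
    by_contra hge
    push Not at hge
    have := mul_le_mul_of_nonneg_right hge hq.le
    rw [one_mul] at this
    linarith
  push_cast at step1 step3 ⊢
  linarith

/-! ### Chains -/

/-- SMALL rational points (the size of NP witnesses): `z = N/d`, `0 < d < 2^W`, `|N_k| < 2^W` — the
fixed width `W` of the apex codes, which dominates the Cramer bounds `D!B^D`, `D·D!·B^D`
(`detBound_lt_two_pow_W`, `rowBound_lt_two_pow_W`). [cite: FournierKoiran2000, §2.2; Schrijver1986, §3.2] -/
def SmallPt (z : Fin Q.D → ℝ) : Prop :=
  ∃ (N : Fin Q.D → ℤ) (d : ℕ), 0 < d ∧ d < 2 ^ Q.W ∧ (∀ k, (N k).natAbs < 2 ^ Q.W) ∧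
    z = fun k => (N k : ℝ) / d

/-- `D! B^D < 2^W`. [folklore] -/
theorem _root_.Literature.Computability.Complexity.FKPointLocation.LevelParams.detBound_lt_two_pow_W
    (Q : LevelParams) : detBound Q.D Q.B < 2 ^ Q.W := by
  have h := Q.width
  have h1 : detBound Q.D Q.B ≤ 2 ^ (Q.L + 1) * detBound Q.D Q.B := Nat.le_mul_of_pos_left _ (by positivity)
  omega

/-- `D · D! B^D < 2^W`. [folklore] -/
theorem _root_.Literature.Computability.Complexity.FKPointLocation.LevelParams.rowBound_lt_two_pow_W
    (Q : LevelParams) : rowBound Q.D Q.B < 2 ^ Q.W := by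
  have h := Q.width
  have hpos : 1 ≤ Q.D * Q.B * 2 ^ (Q.κ * Q.D) := by
    have := Q.D_pos; have := Q.one_le_B
    exact Nat.mul_pos (Nat.mul_pos (by omega) (by omega)) (by positivity)
  have h1 : rowBound Q.D Q.B ≤ rowBound Q.D Q.B * (Q.D * Q.B * 2 ^ (Q.κ * Q.D)) := Nat.le_mul_of_pos_right _ hpos
  omega

/-- A VALID TRIPLE for extending the chain `ch` at scale `sc`: a form of `F sc`, a small point of
`E ch` off it, and a small point of `E ch` on it. [cite: FournierKoiran2000, §2.1 ("there exists `h ∈ H_n^1` such that `dim(h ∩ E_i) = dim E_i - 1`")] -/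
def ValidTriple (sc : ℕ) (ch : List (Fin Q.D → ℤ)) (a : Fin Q.D → ℤ) (z z' : Fin Q.D → ℝ) : Prop :=
  a ∈ Λ.F sc ∧ SmallPt (Q := Q) z ∧ z ∈ Λ.E ch ∧ lin a z ≠ 0 ∧ SmallPt (Q := Q) z' ∧ z' ∈ Λ.E ch ∧ lin a z' = 0

/-- `I sc ⊆ E ch` for a chain of forms of `F sc`. [folklore] -/
theorem I_subset_E {sc : ℕ} {ch : List (Fin Q.D → ℤ)} (hch : ∀ a ∈ ch, a ∈ Λ.F sc) : Λ.I sc ⊆ Λ.E ch := by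
  intro y hy
  rw [mem_I_iff] at hy
  rw [mem_E_iff]
  exact ⟨hy.1, fun a ha => hy.2 a (hch a ha)⟩

/-- A COMPLETE chain (no form of `F sc` cuts `E`) has `E = I sc`.
[cite: FournierKoiran2000, §2.1 ("If `E_i ⊆ h` for all `h ∈ H_n^1` we can halt with `I^1 = E_i`")] -/
theorem E_eq_I_of_complete {sc : ℕ} {ch : List (Fin Q.D → ℤ)} (hch : ∀ a ∈ ch, a ∈ Λ.F sc)
    (hcomp : ∀ a ∈ Λ.F sc, ∀ z ∈ Λ.E ch, lin a z = 0) : Λ.E ch = Λ.I sc := by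
  refine Set.Subset.antisymm (fun y hy => ?_) (Λ.I_subset_E hch)
  rw [mem_I_iff]
  exact ⟨((Λ.mem_E_iff ch y).1 hy).1, fun a ha => hcomp a ha y hy⟩

/-- Small points of a non-empty chain space exist. [cite: Schrijver1986, §3.2] -/
theorem exists_smallPt_mem (hW : Λ.WF) {ch : List (Fin Q.D → ℤ)} (hch : ∀ a ∈ ch, ∀ k, (a k).natAbs ≤ Q.B)
    {extra : List (Eqn Q.D)} (hex : ∀ e ∈ extra, (∀ k, (e.1 k).natAbs ≤ Q.B) ∧ e.2.natAbs ≤ 1)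
    (hne : (SolSet (Λ.Esys ch ++ extra)).Nonempty) :
    ∃ z, SmallPt (Q := Q) z ∧ z ∈ SolSet (Λ.Esys ch ++ extra) := by
  have hB : ∀ e ∈ Λ.Esys ch ++ extra, ∀ k, (e.1 k).natAbs ≤ Q.B := by
    intro e he
    rcases List.mem_append.1 he with he | he
    · exact Λ.esys_entries_le hch e he
    · exact (hex e he).1
  have hβ : ∀ e ∈ Λ.Esys ch ++ extra, e.2.natAbs ≤ 1 := by
    intro e he
    rcases List.mem_append.1 he with he | he
    · exact Λ.esys_consts_le hW ch e he
    · exact (hex e he).2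
  obtain ⟨N, d, hd, hdle, hN, hmem⟩ := exists_small_mem_solSet _ hB hβ hne
  refine ⟨_, ⟨N, d, hd, lt_of_le_of_lt hdle Q.detBound_lt_two_pow_W, fun k => ?_, rfl⟩, hmem⟩
  have := hN k
  rw [mul_one] at this
  exact lt_of_le_of_lt this Q.rowBound_lt_two_pow_W

/-- **Small witnesses**: if some form `a` (bounded by `B`) does not vanish at a point of `E ch`, and
vanishes at another, then a valid pair of SMALL points exists. [cite: FournierKoiran2000, §2.1–2.2 (the NP certificates have polynomial size); Schrijver1986, §3.2] -/
theorem exists_small_witnesses (hW : Λ.WF) {ch : List (Fin Q.D → ℤ)} (hch : ∀ a ∈ ch, ∀ k, (a k).natAbs ≤ Q.B)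
    {a : Fin Q.D → ℤ} (ha : ∀ k, (a k).natAbs ≤ Q.B) {z₁ z₂ : Fin Q.D → ℝ}
    (hz₁ : z₁ ∈ Λ.E ch) (h₁ : lin a z₁ ≠ 0) (hz₂ : z₂ ∈ Λ.E ch) (h₂ : lin a z₂ = 0) :
    ∃ z z', SmallPt (Q := Q) z ∧ z ∈ Λ.E ch ∧ lin a z ≠ 0 ∧ SmallPt (Q := Q) z' ∧ z' ∈ Λ.E ch ∧ lin a z' = 0 := by
  -- `z'`: small point of `E ∩ ker a`
  have hne' : (SolSet (Λ.Esys ch ++ [(a, 0)])).Nonempty := by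
    refine ⟨z₂, fun e he => ?_⟩
    rcases List.mem_append.1 he with he | he
    · exact hz₂ e he
    · simp only [List.mem_singleton] at he; subst he; simpa using h₂
  obtain ⟨z', hsz', hz'⟩ := Λ.exists_smallPt_mem hW hch (extra := [(a, 0)]) (by simpa using ha) hne'
  -- `z`: small point of `E ∩ {a = 1}` (an affine combination of `z₁`, `z₂` lies there)
  have hne : (SolSet (Λ.Esys ch ++ [(a, 1)])).Nonempty := by
    set t : ℝ := 1 / lin a z₁ with ht
    refine ⟨z₂ + t • (z₁ - z₂), fun e he => ?_⟩
    rcases List.mem_append.1 he with he | he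
    · rw [lin_apex, hz₂ e he, hz₁ e he]; ring
    · simp only [List.mem_singleton] at he; subst he
      simp only [Int.cast_one]
      rw [lin_apex, h₂, ht]; field_simp; ring
  obtain ⟨z, hsz, hz⟩ := Λ.exists_smallPt_mem hW hch (extra := [(a, 1)]) (by simpa using ha) hne
  refine ⟨z, z', hsz, fun e he => hz e (List.mem_append_left _ he), ?_, hsz',
    fun e he => hz' e (List.mem_append_left _ he), ?_⟩
  · have := hz (a, 1) (List.mem_append_right _ (List.mem_singleton_self _))
    simp only [Int.cast_one] at this
    rw [this]; exact one_ne_zero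
  · have := hz' (a, 0) (List.mem_append_right _ (List.mem_singleton_self _))
    simpa using this

/-- **A valid triple exists whenever some form of `F sc` does not vanish on `E ch ⊇ I sc`**
(`sc ≤ D+1`, so that `I sc ≠ ∅` supplies the point on the form). [cite: FournierKoiran2000, §2.1 (case (ii): `h ∩ E_i ≠ ∅` since `I ≠ ∅`)] -/
theorem exists_validTriple (hW : Λ.WF) {sc : ℕ} (hsc : sc ≤ Q.D + 1) {ch : List (Fin Q.D → ℤ)}
    (hch : ∀ a ∈ ch, a ∈ Λ.F sc) {a : Fin Q.D → ℤ} (ha : a ∈ Λ.F sc) {z₁ : Fin Q.D → ℝ}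
    (hz₁ : z₁ ∈ Λ.E ch) (h₁ : lin a z₁ ≠ 0) : ∃ z z', Λ.ValidTriple sc ch a z z' := by
  obtain ⟨z₂, hz₂⟩ := Λ.I_nonempty hW hsc
  have hz₂E : z₂ ∈ Λ.E ch := Λ.I_subset_E hch hz₂
  have h₂ : lin a z₂ = 0 := ((Λ.mem_I_iff sc z₂).1 hz₂).2 a ha
  obtain ⟨z, z', hsz, hz, hnz, hsz', hz', h0⟩ :=
    Λ.exists_small_witnesses hW (fun b hb k => Λ.F_entries_le (hch b hb) k) (Λ.F_entries_le ha) hz₁ h₁ hz₂E h₂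
  exact ⟨z, z', ha, hsz, hz, hnz, hsz', hz', h0⟩

/-- Extending the chain by the form of a valid triple strictly lowers the dimension.
[cite: FournierKoiran2000, §2.1 (`dim(h ∩ E_i) = dim E_i - 1`)] -/
theorem finrank_lt_of_validTriple {sc : ℕ} {ch : List (Fin Q.D → ℤ)} {a : Fin Q.D → ℤ}
    {z z' : Fin Q.D → ℝ} (h : Λ.ValidTriple sc ch a z z') :
    finrank ℝ (dirSub (Λ.Esys (ch ++ [a]))) < finrank ℝ (dirSub (Λ.Esys ch)) := by
  obtain ⟨-, -, hz, hnz, -, hz', h0⟩ := h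
  have hsub : SolSet (Λ.Esys (ch ++ [a])) ⊆ SolSet (Λ.Esys ch) := by
    intro y hy
    change y ∈ Λ.E ch
    have hy' : y ∈ Λ.E (ch ++ [a]) := hy
    rw [mem_E_iff] at hy' ⊢
    exact ⟨hy'.1, fun b hb => hy'.2 b (List.mem_append_left _ hb)⟩
  have hz'mem : z' ∈ SolSet (Λ.Esys (ch ++ [a])) := by
    change z' ∈ Λ.E (ch ++ [a])
    rw [mem_E_iff]
    refine ⟨((Λ.mem_E_iff ch z').1 hz').1, fun b hb => ?_⟩
    rcases List.mem_append.1 hb with hb | hb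
    · exact ((Λ.mem_E_iff ch z').1 hz').2 b hb
    · simp only [List.mem_singleton] at hb; subst hb; exact h0
  have hne : SolSet (Λ.Esys (ch ++ [a])) ≠ SolSet (Λ.Esys ch) := by
    intro heq
    have : z ∈ Λ.E (ch ++ [a]) := by change z ∈ SolSet _; rw [heq]; exact hz
    rw [mem_E_iff] at this
    exact hnz (this.2 a (List.mem_append_right _ (List.mem_singleton_self _)))
  exact finrank_dirSub_lt_of_ssubset hsub hz'mem hne

open Classical in
/-- One chain slot relative to a selection function `choose`: if a valid triple exists, append the
selected form. [cite: FournierKoiran2000, §2.1 ("such an `h` can be determined by prefix search")] -/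
noncomputable def chainStep (choose : ℕ → List (Fin Q.D → ℤ) → (Fin Q.D → ℤ)) (sc : ℕ)
    (ch : List (Fin Q.D → ℤ)) : List (Fin Q.D → ℤ) :=
  if ∃ a z z', Λ.ValidTriple sc ch a z z' then ch ++ [choose sc ch] else ch

/-- `k` chain slots from the empty chain. [cite: FournierKoiran2000, §2.1] -/
noncomputable def chainBuild (Λ : LevelCtx Q) (choose : ℕ → List (Fin Q.D → ℤ) → (Fin Q.D → ℤ)) (sc : ℕ) :
    ℕ → List (Fin Q.D → ℤ)
  | 0 => []
  | k + 1 => Λ.chainStep choose sc (chainBuild Λ choose sc k)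

/-- A selection function is SOUND if it returns the form of some valid triple whenever one exists
(prefix search does). [cite: FournierKoiran2000, §2.1] -/
def SoundChoose (choose : ℕ → List (Fin Q.D → ℤ) → (Fin Q.D → ℤ)) : Prop :=
  ∀ sc ch, (∃ a z z', Λ.ValidTriple sc ch a z z') → ∃ z z', Λ.ValidTriple sc ch (choose sc ch) z z'

variable {choose : ℕ → List (Fin Q.D → ℤ) → (Fin Q.D → ℤ)}

/-- Chains consist of forms of `F sc`. [folklore] -/
theorem chainBuild_subset (hs : Λ.SoundChoose choose) (sc : ℕ) :
    ∀ k, ∀ a ∈ Λ.chainBuild choose sc k, a ∈ Λ.F sc := by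
  intro k
  induction k with
  | zero => simp [chainBuild]
  | succ k ih =>
    intro a ha
    rw [chainBuild, chainStep] at ha
    split_ifs at ha with h
    · rcases List.mem_append.1 ha with ha | ha
      · exact ih a ha
      · simp only [List.mem_singleton] at ha; subst ha
        exact (hs sc _ h).choose_spec.choose_spec.1
    · exact ih a ha

/-- The dimension drops by at least the number of slots, unless the chain got stuck (became
complete). [folklore] -/
theorem chainBuild_dichotomy (hs : Λ.SoundChoose choose) (sc : ℕ) : ∀ k,
    (∃ k' ≤ k, ¬ ∃ a z z', Λ.ValidTriple sc (Λ.chainBuild choose sc k') a z z') ∨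
      finrank ℝ (dirSub (Λ.Esys (Λ.chainBuild choose sc k))) + k ≤ Q.D := by
  intro k
  induction k with
  | zero =>
    right
    rw [Nat.add_zero]
    exact finrank_dirSub_le _
  | succ k ih =>
    rcases ih with ⟨k', hk', hstuck⟩ | hdim
    · exact Or.inl ⟨k', by omega, hstuck⟩
    · by_cases h : ∃ a z z', Λ.ValidTriple sc (Λ.chainBuild choose sc k) a z z'
      · right
        have hstep : Λ.chainBuild choose sc (k + 1) =
            Λ.chainBuild choose sc k ++ [choose sc (Λ.chainBuild choose sc k)] := by
          rw [chainBuild, chainStep, if_pos h]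
        obtain ⟨z, z', hv⟩ := hs sc _ h
        have := Λ.finrank_lt_of_validTriple hv
        rw [hstep]; omega
      · exact Or.inl ⟨k, by omega, h⟩

/-- Once stuck, the chain no longer changes. [folklore] -/
theorem chainBuild_stuck (sc : ℕ) {k' : ℕ}
    (hstuck : ¬ ∃ a z z', Λ.ValidTriple sc (Λ.chainBuild choose sc k') a z z') :
    ∀ k, k' ≤ k → Λ.chainBuild choose sc k = Λ.chainBuild choose sc k' := by
  intro k hk
  obtain ⟨i, rfl⟩ := Nat.exists_eq_add_of_le hk
  induction i with
  | zero => rfl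
  | succ i ih =>
    rw [← Nat.add_assoc, chainBuild, ih (by omega), chainStep, if_neg hstuck]

/-- **After `D+1` slots the chain is complete: `E = I sc`** (`sc ≤ D+1`).
[cite: FournierKoiran2000, §2.1 ("note that `j ≤ n`"; halting with `I^1 = E_i`)] -/
theorem E_chainBuild_eq_I (hs : Λ.SoundChoose choose) (hW : Λ.WF) {sc : ℕ} (hsc : sc ≤ Q.D + 1) :
    Λ.E (Λ.chainBuild choose sc (Q.D + 1)) = Λ.I sc := by
  have hsub := Λ.chainBuild_subset hs sc
  -- the chain is stuck at some slot `k' ≤ D+1`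
  obtain ⟨k', hk', hstuck⟩ : ∃ k' ≤ Q.D + 1, ¬ ∃ a z z', Λ.ValidTriple sc (Λ.chainBuild choose sc k') a z z' := by
    rcases Λ.chainBuild_dichotomy hs sc (Q.D + 1) with ⟨k', hk', h⟩ | hdim
    · exact ⟨k', hk', h⟩
    · omega
  rw [Λ.chainBuild_stuck sc hstuck (Q.D + 1) hk']
  refine Λ.E_eq_I_of_complete (hsub k') fun a ha z hz => ?_
  by_contra hne
  obtain ⟨z₀, z₀', hv⟩ := Λ.exists_validTriple hW hsc (hsub k') ha hz hne
  exact hstuck ⟨a, z₀, z₀', hv⟩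

/-! ### The stable scale -/

/-- The final chain of scale `sc` (after `D+1` slots). [cite: FournierKoiran2000, §2.1] -/
noncomputable def chainOf (choose : ℕ → List (Fin Q.D → ℤ) → (Fin Q.D → ℤ)) (sc : ℕ) : List (Fin Q.D → ℤ) :=
  Λ.chainBuild choose sc (Q.D + 1)

/-- STABILITY TEST of scale `sc`: some form of the next family `F (sc+1)` does not vanish at a
small point of `E (chainOf sc)` (`= I sc`). [cite: FournierKoiran2000, §2.1 (comparing `H^k` at two radii — this tree's adaptive radius)] -/
def Unstable (choose : ℕ → List (Fin Q.D → ℤ) → (Fin Q.D → ℤ)) (sc : ℕ) : Prop :=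
  ∃ a ∈ Λ.F (sc + 1), ∃ z, SmallPt (Q := Q) z ∧ z ∈ Λ.E (Λ.chainOf choose sc) ∧ lin a z ≠ 0

/-- If scale `sc` is unstable then `I (sc+1) ⊊ I sc` and the dimension drops. [folklore] -/
theorem finrank_lt_of_unstable (hs : Λ.SoundChoose choose) (hW : Λ.WF) {sc : ℕ} (hsc : sc + 1 ≤ Q.D + 1)
    (h : Λ.Unstable choose sc) :
    finrank ℝ (dirSub (Λ.Isys (sc + 1))) < finrank ℝ (dirSub (Λ.Isys sc)) := by
  obtain ⟨a, ha, z, -, hz, hnz⟩ := h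
  rw [Λ.E_chainBuild_eq_I hs hW (by omega) |> fun h => show Λ.E (Λ.chainOf choose sc) = Λ.I sc from h] at hz
  obtain ⟨z', hz'⟩ := Λ.I_nonempty hW hsc
  refine finrank_dirSub_lt_of_ssubset (Λ.I_antitone (Nat.le_succ sc)) hz' fun heq => ?_
  have : z ∈ Λ.I (sc + 1) := by change z ∈ SolSet _; rw [heq]; exact hz
  exact hnz (((Λ.mem_I_iff _ z).1 this).2 a ha)

/-- **Some scale `sc ≤ D` is stable** (the dimension cannot drop `D+1` times).
[cite: FournierKoiran2000, §2.1 (dimension count)] -/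
theorem exists_stable (hs : Λ.SoundChoose choose) (hW : Λ.WF) : ∃ sc ≤ Q.D, ¬ Λ.Unstable choose sc := by
  by_contra hall
  push Not at hall
  have key : ∀ sc ≤ Q.D + 1, finrank ℝ (dirSub (Λ.Isys sc)) + sc ≤ Q.D := by
    intro sc
    induction sc with
    | zero => intro _; simpa using finrank_dirSub_le (Λ.Isys 0)
    | succ sc ih =>
      intro hsc
      have h1 := ih (by omega)
      have h2 := Λ.finrank_lt_of_unstable hs hW hsc (hall sc (by omega))
      omega
  have := key (Q.D + 1) le_rfl
  omega

open Classical in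
/-- The STABLE SCALE: the first `sc ∈ [0, D]` that is not unstable (`D+1` if none — which does not
happen for well-formed contexts, `scStar_spec`). Proof-free (a `findIdx`), as computed by the
protocol from the answers to the stability queries. [cite: FournierKoiran2000, §2.1] -/
noncomputable def scStar (choose : ℕ → List (Fin Q.D → ℤ) → (Fin Q.D → ℤ)) : ℕ :=
  (List.range (Q.D + 1)).findIdx fun sc => decide (¬ Λ.Unstable choose sc)

/-- `scStar ≤ D` and it is stable. [folklore] -/
theorem scStar_spec (hs : Λ.SoundChoose choose) (hW : Λ.WF) :
    Λ.scStar choose ≤ Q.D ∧ ¬ Λ.Unstable choose (Λ.scStar choose) := by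
  classical
  obtain ⟨sc, hsc, hst⟩ := Λ.exists_stable hs hW
  have hmem : sc ∈ List.range (Q.D + 1) := List.mem_range.2 (by omega)
  have hlt : Λ.scStar choose < (List.range (Q.D + 1)).length :=
    List.findIdx_lt_length_of_exists ⟨sc, hmem, by simpa using hst⟩
  have hlen : (List.range (Q.D + 1)).length = Q.D + 1 := List.length_range
  refine ⟨by rw [hlen] at hlt; exact Nat.lt_succ_iff.1 hlt, ?_⟩
  have h := List.findIdx_getElem (w := hlt)
  simp only [List.getElem_range, decide_eq_true_eq] at h
  exact h

/-- Smaller scales are unstable. [folklore] -/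
theorem unstable_of_lt_scStar {sc : ℕ} (h : sc < Λ.scStar choose) : Λ.Unstable choose sc := by
  classical
  have hlen : (List.range (Q.D + 1)).length = Q.D + 1 := List.length_range
  have hle : Λ.scStar choose ≤ Q.D + 1 := by
    have := List.findIdx_le_length (p := fun sc => decide (¬ Λ.Unstable choose sc)) (xs := List.range (Q.D + 1))
    rwa [hlen] at this
  have hsc : sc < (List.range (Q.D + 1)).length := by rw [hlen]; omega
  have := List.not_of_lt_findIdx h
  simp only [List.getElem_range] at this
  by_contra hne
  rw [decide_eq_true hne] at this
  exact Bool.noConfusion this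

/-- **At a stable scale the two families define the same space: `I (sc+1) = I sc`.**
[cite: FournierKoiran2000, §2.1] -/
theorem I_succ_eq_of_stable (hs : Λ.SoundChoose choose) (hW : Λ.WF) {sc : ℕ} (hsc : sc ≤ Q.D)
    (hst : ¬ Λ.Unstable choose sc) : Λ.I (sc + 1) = Λ.I sc := by
  refine Set.Subset.antisymm (Λ.I_antitone (Nat.le_succ sc)) fun y hy => ?_
  rw [mem_I_iff] at hy ⊢
  refine ⟨hy.1, fun a ha => ?_⟩
  by_contra hne
  apply hst
  -- small witness inside `E (chainOf sc) = I sc`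
  have hE : Λ.E (Λ.chainOf choose sc) = Λ.I sc := Λ.E_chainBuild_eq_I hs hW (by omega)
  have hyE : y ∈ Λ.E (Λ.chainOf choose sc) := by rw [hE]; exact (Λ.mem_I_iff sc y).2 hy
  obtain ⟨z₂, hz₂⟩ := Λ.I_nonempty hW (show sc + 1 ≤ Q.D + 1 by omega)
  have hz₂E : z₂ ∈ Λ.E (Λ.chainOf choose sc) := by rw [hE]; exact Λ.I_antitone (Nat.le_succ sc) hz₂
  have h₂ : lin a z₂ = 0 := ((Λ.mem_I_iff _ z₂).1 hz₂).2 a ha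
  have hchB : ∀ b ∈ Λ.chainOf choose sc, ∀ k, (b k).natAbs ≤ Q.B :=
    fun b hb k => Λ.F_entries_le (Λ.chainBuild_subset hs sc _ b hb) k
  obtain ⟨z, -, hsz, hz, hnz, -, -, -⟩ := Λ.exists_small_witnesses hW hchB (Λ.F_entries_le ha) hyE hne hz₂E h₂
  exact ⟨a, ha, z, hsz, hz, hnz⟩

/-! ### The apex -/

/-- The ARITHMETIC APEX PREDICATE at the stable scale `sc`: `s = N/d` with `0 < d < 2^W`,
`|N_k| < 2^W`, solving the system of `chainOf sc` (so `s ∈ I sc`), and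
`4 |N_i 2^{L+1} - m_i d| ≤ d 2^{κ(sc+1)}` on free coordinates (`|s - p|_∞ ≤ ρ_{sc+1}/4`).
[cite: FournierKoiran2000, §2.1 ("we can easily compute a point `s_n^1` on this affine space"), here found by prefix search] -/
def ApexPred (choose : ℕ → List (Fin Q.D → ℤ) → (Fin Q.D → ℤ)) (sc : ℕ) (N : Fin Q.D → ℤ) (d : ℕ) : Prop :=
  0 < d ∧ d < 2 ^ Q.W ∧ (∀ k, (N k).natAbs < 2 ^ Q.W) ∧
    (∀ e ∈ Λ.Esys (Λ.chainOf choose sc), ∑ k, e.1 k * N k = e.2 * d) ∧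
    ∀ i, Λ.χ i = 0 → 4 * (N i * 2 ^ (Q.L + 1) - Λ.m i * d).natAbs ≤ d * 2 ^ (Q.κ * (sc + 1))

/-- A point satisfying the integer system lies in `E`. [folklore] -/
theorem mem_E_of_intSol {ch : List (Fin Q.D → ℤ)} {N : Fin Q.D → ℤ} {d : ℕ} (hd : 0 < d)
    (hsol : ∀ e ∈ Λ.Esys ch, ∑ k, e.1 k * N k = e.2 * d) :
    (fun k => (N k : ℝ) / d) ∈ Λ.E ch := by
  intro e he
  have hdR : (d : ℝ) ≠ 0 := by exact_mod_cast hd.ne'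
  have := hsol e he
  have h' : ((∑ k, e.1 k * N k : ℤ) : ℝ) = ((e.2 * d : ℤ) : ℝ) := by rw [this]
  push_cast at h'
  simp only [lin]
  rw [show ∑ i, (e.1 i : ℝ) * ((N i : ℝ) / d) = (∑ i, (e.1 i : ℝ) * N i) / d by
    rw [sum_div]; exact sum_congr rfl fun i _ => by ring, h', mul_div_assoc, div_self hdR, mul_one]

/-- **An apex satisfying the predicate exists at the stable scale** (the generalized-inverse solution
near `p`: coarseness gives consistency, `LevelParams.near` the distance, `LevelParams.width` the size).
[cite: FournierKoiran2000, §2.1–2.2 (existence and size of `s_n^k`)] -/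
theorem exists_apexPred (hs : Λ.SoundChoose choose) (hW : Λ.WF) :
    ∃ N d, Λ.ApexPred choose (Λ.scStar choose) N d := by
  set sc := Λ.scStar choose with hscdef
  have hsc : sc ≤ Q.D := (Λ.scStar_spec hs hW).1
  set ch := Λ.chainOf choose sc with hchdef
  have hchF : ∀ a ∈ ch, a ∈ Λ.F sc := Λ.chainBuild_subset hs sc _
  have hchB : ∀ a ∈ ch, ∀ k, (a k).natAbs ≤ Q.B := fun a ha k => Λ.F_entries_le (hchF a ha) k
  have hE : Λ.E ch = Λ.I sc := Λ.E_chainBuild_eq_I hs hW (by omega)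
  have hne : (SolSet (Λ.Esys ch)).Nonempty := by
    change (Λ.E ch).Nonempty; rw [hE]; exact Λ.I_nonempty hW (by omega)
  have hq : 0 < 2 ^ (Q.L + 1) := by positivity
  -- integer residuals at `p = m / 2^{L+1}`
  set R : ℕ := Q.D * Q.B * 2 ^ (Q.κ * sc) with hR
  have hres : ∀ e ∈ Λ.Esys ch, (((2 ^ (Q.L + 1) : ℕ) : ℤ) * e.2 - ∑ k, e.1 k * Λ.m k).natAbs ≤ R := by
    classical
    intro e he
    rw [Esys, List.mem_append, List.mem_map] at he
    rcases he with he | ⟨a, ha, rfl⟩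
    · obtain ⟨i, hi, rfl⟩ := Λ.mem_chartEqns.1 he
      have : ∑ k, (Pi.single i (1 : ℤ) : Fin Q.D → ℤ) k * Λ.m k = Λ.m i := by
        rw [sum_eq_single i]
        · simp
        · intro j _ hj; simp [hj]
        · simp
      simp only [this, hW.hm i hi]
      push_cast
      rw [show (2 : ℤ) ^ (Q.L + 1) * Λ.χ i - Λ.χ i * 2 ^ (Q.L + 1) = 0 by ring]
      simp
    · have hmeets := (Λ.mem_F.1 (hchF a ha)).2
      simp only [mul_zero, zero_sub, Int.natAbs_neg]
      refine hmeets.trans ?_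
      rw [hR, mul_comm (Q.D * Q.B)]
      refine Nat.mul_le_mul_left _ ?_
      calc ∑ i ∈ univ.filter (fun i => Λ.χ i = 0), (a i).natAbs ≤ ∑ i : Fin Q.D, (a i).natAbs :=
            sum_le_sum_of_subset_of_nonneg (filter_subset _ _) fun i _ _ => Nat.zero_le _
        _ ≤ ∑ _i : Fin Q.D, Q.B := sum_le_sum fun i _ => (Λ.mem_F.1 (hchF a ha)).1.1 i
        _ = Q.D * Q.B := by simp
  obtain ⟨N, d, hd, hdle, hN, hnear, hmem⟩ :=
    exists_near_mem_solSet (Λ.Esys ch) (Λ.esys_entries_le hchB) hne Λ.m hq hres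
  have hdet := Q.detBound_eq
  refine ⟨N, d, hd, ?_, fun k => ?_, fun e he => ?_, fun i hi => ?_⟩
  · -- `d ≤ 2^{L+1} D! B^D < 2^W`
    have := Q.width
    calc d ≤ 2 ^ (Q.L + 1) * detBound Q.D Q.B := hdle
      _ < 2 ^ Q.W := by
        have h0 : 0 ≤ rowBound Q.D Q.B * (Q.D * Q.B * 2 ^ (Q.κ * Q.D)) := Nat.zero_le _
        omega
  · -- `|N_k| ≤ |m_k| D!B^D + rowBound · R < 2^W`
    have h1 := hN k
    have h2 : (Λ.m k).natAbs * detBound Q.D Q.B ≤ 2 ^ (Q.L + 1) * detBound Q.D Q.B :=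
      Nat.mul_le_mul_right _ (hW.hm_le k)
    have h3 : rowBound Q.D Q.B * R ≤ rowBound Q.D Q.B * (Q.D * Q.B * 2 ^ (Q.κ * Q.D)) := by
      refine Nat.mul_le_mul_left _ ?_
      rw [hR]
      exact Nat.mul_le_mul_left _ (Nat.pow_le_pow_right (by norm_num) (Nat.mul_le_mul_left _ hsc))
    have := Q.width
    omega
  · -- the integer identity from the real membership
    have hm := hmem e he
    have hdR : (d : ℝ) ≠ 0 := by exact_mod_cast hd.ne'
    simp only [lin] at hm
    have h' : (∑ k, (e.1 k : ℝ) * N k) = (e.2 : ℝ) * d := by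
      have : ∑ i, (e.1 i : ℝ) * ((N i : ℝ) / d) = (∑ i, (e.1 i : ℝ) * N i) / d := by
        rw [Finset.sum_div]; exact sum_congr rfl fun i _ => by ring
      rw [this, div_eq_iff hdR] at hm
      exact hm
    exact_mod_cast h'
  · -- nearness: `|N_i/d - m_i/2^{L+1}| ≤ rowBound · R / 2^{L+1}` and `8 rowBound D B ≤ 2^κ`
    have h1 := hnear i
    have hdR : (0 : ℝ) < d := by exact_mod_cast hd
    have hqR : (0 : ℝ) < 2 ^ (Q.L + 1) := by positivity
    have hx : (N i : ℝ) / d - (Λ.m i : ℝ) / ((2 ^ (Q.L + 1) : ℕ) : ℝ) =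
        ((N i : ℝ) * 2 ^ (Q.L + 1) - Λ.m i * d) / (d * 2 ^ (Q.L + 1)) := by
      push_cast; field_simp
    rw [hx, abs_div, abs_of_pos (show (0 : ℝ) < d * 2 ^ (Q.L + 1) by positivity),
      div_le_iff₀ (show (0 : ℝ) < d * 2 ^ (Q.L + 1) by positivity)] at h1
    have h2 : |(N i : ℝ) * 2 ^ (Q.L + 1) - Λ.m i * d| ≤ rowBound Q.D Q.B * R * d :=
      le_trans h1 (le_of_eq (by push_cast; field_simp))
    have h3 : (8 : ℝ) * (rowBound Q.D Q.B * R) ≤ 2 ^ (Q.κ * (sc + 1)) := by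
      have hn : ((8 * (rowBound Q.D Q.B * (Q.D * Q.B)) : ℕ) : ℝ) ≤ ((2 ^ Q.κ : ℕ) : ℝ) := by
        exact_mod_cast Q.near
      push_cast at hn
      rw [hR]; push_cast
      rw [show Q.κ * (sc + 1) = Q.κ * sc + Q.κ by ring, pow_add]
      have hp : (0 : ℝ) ≤ 2 ^ (Q.κ * sc) := by positivity
      nlinarith
    have h4 : (4 : ℝ) * |(N i : ℝ) * 2 ^ (Q.L + 1) - Λ.m i * d| ≤ d * 2 ^ (Q.κ * (sc + 1)) := by
      nlinarith [h2, h3, abs_nonneg ((N i : ℝ) * 2 ^ (Q.L + 1) - Λ.m i * d)]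
    have h5 : ((4 * (N i * 2 ^ (Q.L + 1) - Λ.m i * d).natAbs : ℕ) : ℝ) ≤ ((d * 2 ^ (Q.κ * (sc + 1)) : ℕ) : ℝ) := by
      rw [Nat.cast_mul, Nat.cast_natAbs, Int.cast_abs]
      push_cast
      exact h4
    exact_mod_cast h5

/-- **The apex property.** Any apex satisfying the predicate at the stable scale `sc = scStar` lies
in the chart, is within `ρ_{sc+1}/4` of the centre, and KILLS EVERY LIVE FORM MEETING THE CUBE OF
RADIUS `ρ_{sc+1}` (fields `Valid.s_fixed`, `Valid.s_near`, `Valid.apex` of level `j`).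
[cite: FournierKoiran2000, §2.1 Step k (all hyperplanes of `H_n^k` pass through `s_n^k`)] -/
theorem apex_property (hs : Λ.SoundChoose choose) (hW : Λ.WF) {N : Fin Q.D → ℤ} {d : ℕ}
    (hA : Λ.ApexPred choose (Λ.scStar choose) N d) :
    (∀ i, Λ.χ i ≠ 0 → (N i : ℚ) / d = Λ.χ i) ∧
    (∀ i, Λ.χ i = 0 → |(N i : ℚ) / d - Λ.pC i| ≤ Q.ρ (Λ.scStar choose + 1) / 4) ∧
    ∀ a, Λ.LiveI a → Meets Λ.χ Λ.pC (Q.ρ (Λ.scStar choose + 1)) a → ∑ i, (a i : ℚ) * ((N i : ℚ) / d) = 0 := by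
  set sc := Λ.scStar choose with hscdef
  obtain ⟨hd, -, -, hsol, hnear⟩ := hA
  have hsR := Λ.mem_E_of_intSol hd hsol
  have hdQ : (0 : ℚ) < d := by exact_mod_cast hd
  refine ⟨fun i hi => ?_, fun i hi => ?_, fun a hlive hmeets => ?_⟩
  · -- chart membership from the chart equations
    have := ((Λ.mem_E_iff _ _).1 hsR).1 i hi
    have h' : ((N i : ℚ) / d : ℝ) = ((Λ.χ i : ℚ) : ℝ) := by push_cast; exact this
    exact_mod_cast h'
  · have h1 := hnear i hi
    have hq : (0 : ℚ) < 2 ^ (Q.L + 1) := by positivity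
    have hd0 : (d : ℚ) ≠ 0 := hdQ.ne'
    have h2 : ((4 * (N i * 2 ^ (Q.L + 1) - Λ.m i * d).natAbs : ℕ) : ℚ) ≤ ((d * 2 ^ (Q.κ * (sc + 1)) : ℕ) : ℚ) := by
      exact_mod_cast h1
    rw [Nat.cast_mul, Nat.cast_natAbs, Int.cast_abs] at h2
    push_cast at h2
    have hx : (N i : ℚ) / d - Λ.pC i = ((N i : ℚ) * 2 ^ (Q.L + 1) - Λ.m i * d) / (d * 2 ^ (Q.L + 1)) := by
      rw [pC]; field_simp
    rw [hx, abs_div, abs_of_pos (show (0 : ℚ) < d * 2 ^ (Q.L + 1) by positivity),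
      div_le_iff₀ (show (0 : ℚ) < d * 2 ^ (Q.L + 1) by positivity), LevelParams.ρ]
    have : (2 : ℚ) ^ (Q.κ * (sc + 1)) / 2 ^ (Q.L + 1) / 4 * (d * 2 ^ (Q.L + 1)) = d * 2 ^ (Q.κ * (sc + 1)) / 4 := by
      field_simp
    rw [this]
    linarith [h2]
  · -- the live form meeting the cube belongs to `F (sc+1)`, hence vanishes on `I (sc+1) = I sc ∋ s`
    have haF : a ∈ Λ.F (sc + 1) := Λ.mem_F.2 ⟨hlive, (Λ.meetsI_iff hW _ a).2 hmeets⟩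
    have hE : Λ.E (Λ.chainOf choose sc) = Λ.I sc := Λ.E_chainBuild_eq_I hs hW (by have := (Λ.scStar_spec hs hW).1; omega)
    have hI : Λ.I (sc + 1) = Λ.I sc := Λ.I_succ_eq_of_stable hs hW (Λ.scStar_spec hs hW).1 (Λ.scStar_spec hs hW).2
    have hsI : (fun k => (N k : ℝ) / d) ∈ Λ.I (sc + 1) := by rw [hI, ← hE]; exact hsR
    have h0 : lin a (fun k => (N k : ℝ) / d) = 0 := ((Λ.mem_I_iff _ _).1 hsI).2 a haF
    have h' : ((∑ i, (a i : ℚ) * ((N i : ℚ) / d) : ℚ) : ℝ) = 0 := by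
      simp only [lin] at h0; push_cast; exact h0
    exact_mod_cast h'

end LevelCtx

end FKPointLocation

end Literature.Computability.Complexity
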